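import Summits.BirchSwinnertonDyer.BirchSwinnertonDyer.Theorems.InertBadSignedBranchesCccOneLawOnTypeIstarZeroHasPRRatio
import Summits.BirchSwinnertonDyer.BirchSwinnertonDyer.Theorems.InertBadSignedBranchesCccOneLawOnTypeIstarZeroPerrinRiouSplit
import Summits.BirchSwinnertonDyer.Rank1Residual.Additive.KatoDescentClosedBindersContra
import Summits.BirchSwinnertonDyer.Rank1Residual.Additive.KatoDescentRankOneCountRowsOfLoc
import Summits.BirchSwinnertonDyer.Rank1Residual.Additive.KatoDescentRealizableContraRankOne
import HarnessLib

set_option linter.dupNamespace false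
set_option autoImplicit false

/-!
# `CccOneLawOnTypeIstarZero` (stmt-BirchSwinnertonDyer-19223), line `kato_perrin_riou_istar` v13 —
# the (NV) half of research stub 1b is a CONSEQUENCE of the line's KMC side; PR^× on the rows ⟸ KMC-fine + (VAL) alone

Refill hand `leafhand-bsd-inertbadsignedbran-7` g0 (prover), 2026-08-31; DEF-FREE helper `--supports 19223 --as helper`.
Skeleton of record v13 `e3781ce8aaf94304` (planner bsd-cm-plan g40, D1177).  Nothing registered, no stub closed by this file
alone; BSD is proved for no curve.

## What this file proves (kernel)

v13's research stub 1b `stub_perrinRiouLawIstarZero` is (NV) ∧ (VAL): on every row `(p ≥ 5, I₀*, r_an = 1)`, every `ℒ` with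
`Kato2004.PRRatio W p ℒ` is non-zero (NV) and `∃ q : ℚ, L′(W,1)/(Ω_W·Reg W) = q ∧ v(ℒ) = v_p(q)` (VAL).  The composition head of the
line ALSO consumes `kmcFine_closed : … → KatoMainConjectureFineContra W p` on the same rows.  But Kato's Conj. 12.10 (fine,
contragredient key) on a row already FORCES Perrin-Riou's non-vanishing there — Burns–Kurihara–Sano Conj. 2.8 (i) from the
count `[A : z] = #(𝐇²)_Γ ≠ 0`: the tree's count reading on the rows (`StrictCount.rankOneCountReading_istarZero_of_loc_of_modularity`,
E53: `ℒ ≠ 0 ↔ D.zetaIndex ≠ 0`, `(𝐇²)_Γ` finite), the row realisability of a Kato descent datum of the contragredient key from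
H2X′ (`StrictCount.realizableIstarZeroOfGZK_of_loc`, E54), the kernel interface `conj1210_of_isKatoZetaDescentDatumOfContra_of_
katoMainConjectureFineContra` (p628155) and the descent `KatoDescentDatum.zetaIndex_eq_h2Card_of_conj1210` — the binder-level
argument of `KatoDescentKMCImpReading.perrinRiou_nonvanishing_of_kmcImp`, here at the closed contragredient pair on the rows.

* §1 `perrinRiouNonvanishingIstarZero_of_kmcFineContra (hloc : H2X′) (hmod : modularity) (hGZK)`: on every row,
  `KatoMainConjectureFineContra W p → ∀ ℒ, Kato2004.PRRatio W p ℒ → ℒ ≠ 0` — (NV) ⟸ the KMC side.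
* §2 `perrinRiouRatioIstarZero_of_valuation_of_kmcFineContra (hloc) (hmod) (hFCM) (hGZK) (hKMC : rows → KatoMainConjectureFineContra W p)
  (hVAL : rows → ∀ ℒ, PRRatio W p ℒ → ∃ q, L′(W,1)/(Ω_W·Reg W) = q ∧ v(ℒ) = v_p(q))`: on every row `PerrinRiouUpToUnitAt Kato2004.PRRatio W p`
  — the TYPE of the skeleton's `perrinRiouRatioIstarZero_closed` (= v4–v12's research stub 1 VERBATIM) — from (E) (sibling file
  `…IstarZeroHasPRRatio`, `CccOneHasPRRatio.hasPRRatioIstarZero_of_facts`, F-CM + GZK), (NV) (§1) and (VAL), recomposed by hand -6's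
  `CccOnePerrinRiouSplit.perrinRiouUpToUnitAt_iff_exists_and_forall_onType_IstarZero`.

READING for the planner (nothing registered here): with `hKMC := fun p _ hp W _ _ hT hr => kmcFine_closed p hp W hT hr` and the cite
conjuncts `stub_printFactsKato.1 / .2.1 / .2.2.1`, `stub_printInputsInert.2`, the skeleton's `perrinRiouRatioIstarZero_closed` needs from
stub 1b ONLY its (VAL) projection; i.e. the research content of PR^× on the rows, GIVEN the KMC side the line already carries
(2c-T1, 2c-T2, 6a, BT26, F-CM), is the single valuation identity (VAL) = Burns–Kurihara–Sano Conj. 2.8 (ii) up to a `p`-adic unit.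
STRENGTH BOOKKEEPING: (NV) is not dropped but DERIVED (§1); no strength added: (E) ∧ (NV) ∧ (VAL) ⟺ PR^× (hand -6, both directions).

Honest label: CONDITIONAL on the named facts H2X′, modularity, F-CM, GZK (all cite conjuncts of the line) and on the displayed
hypotheses `hKMC`, `hVAL`; (VAL), Kato's Main Conjecture, Perrin-Riou's conjecture and BSD are NOT proved; 19223 stays OPEN.

References: [BurnsKuriharaSano2019] Conj. 2.8 (i)–(ii) (p. 10), Thm. 7.6 (p. 29); [Kato2004Asterisque] Conj. 12.10 (p. 224), §13.9
(p. 230), §14.14 and Lemma 14.15 (pp. 243–244), (17.13.1) (p. 279); [PerrinRiou1993AIF] §3.3.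
-/

noncomputable section

open scoped Classical NumberField

open WeierstrassCurve Field
open Literature.NumberTheory.EllipticCurves Literature.NumberTheory.EllipticCurves.Kato2004
  Literature.NumberTheory.EllipticCurves.ModularForms
open Summit.BirchSwinnertonDyer.Rank1Residual Summit.BirchSwinnertonDyer.Rank1Residual.Additive
open Summit.BirchSwinnertonDyer.Rank1Residual.X12.O10
open Summit.BirchSwinnertonDyer.BirchSwinnertonDyer.Theorems

namespace Summit.BirchSwinnertonDyer.BirchSwinnertonDyer.Theorems.CccOneHasPRRatio

/-! ## §1 (NV) on the rows from Kato's Conj. 12.10 (fine, contragredient key) -/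

/-- **Perrin-Riou's NON-VANISHING on the rows from the KMC side.**  For every rank-one pair of the signed type `(p, I₀*)`, `p ≥ 5`,
granted H2X′ (`Kato2004.exists_iwasawaH2Data_fineSelmerDual_embedding_loc`), modularity (`ModularForms.exists_isNewformOf`) and GZK:
if `KatoMainConjectureFineContra W p` holds then EVERY Perrin-Riou ratio `ℒ` of `(W, p)` is non-zero.  Proof: a Kato descent datum
`D` of the contragredient key is realised on the row (E54, from H2X′ + GZK); the count reading (E53) gives `(𝐇²)_Γ` finite and
`ℒ ≠ 0 ↔ [A : z] ≠ 0`; Conj. 12.10 for the datum (kernel interface at the closed pair) gives `[A : z] = #(𝐇²)_Γ ≥ 1`.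
CONDITIONAL on the three named facts and the displayed `KatoMainConjectureFineContra W p`; nothing else asserted.
[cite: BurnsKuriharaSano2019, Conj. 2.8 (i) (p. 10), Thm. 7.6 (p. 29)] [cite: Kato2004Asterisque, Conj. 12.10 (p. 224), §14.14 and Lemma 14.15 (pp. 243–244)] -/
theorem perrinRiouNonvanishingIstarZero_of_kmcFineContra
    (hloc : Kato2004.exists_iwasawaH2Data_fineSelmerDual_embedding_loc) (hmod : ModularForms.exists_isNewformOf)
    (hGZK : rank_eq_analyticRank_of_analyticRank_le_one) :
    ∀ (p : ℕ) [Fact p.Prime], 5 ≤ p → ∀ (W : WeierstrassCurve ℚ) [W.IsElliptic] [W.IsGloballyMinimal],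
      HasSignedLocalType W p (.Istar 0) → W.analyticRank = 1 → KatoMainConjectureFineContra W p →
      ∀ ℒ : ℚ_[p], Kato2004.PRRatio W p ℒ → ℒ ≠ 0 := by
  intro p _ hp5 W _ _ hT hr hKMC ℒ hℒ
  obtain ⟨D, hD⟩ := StrictCount.realizableIstarZeroOfGZK_of_loc hloc hGZK p hp5 W hT hr hKMC
  obtain ⟨hfin, hiff, -⟩ :=
    StrictCount.rankOneCountReading_istarZero_of_loc_of_modularity hGZK hmod hloc p hp5 W hT hr D ℒ hD hℒ
  have h1210 : D.Conj1210 := conj1210_of_isKatoZetaDescentDatumOfContra_of_katoMainConjectureFineContra hD hKMC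
  exact hiff.mpr (by rw [D.zetaIndex_eq_h2Card_of_conj1210 hfin h1210]; exact (D.h2Card_pos hfin).ne')

/-! ## §2 PR^× on the rows from the KMC side + (VAL) alone -/

/-- **`PerrinRiouUpToUnitAt Kato2004.PRRatio W p` on the rows from `KatoMainConjectureFineContra` on the rows and the VALUATION
identity (VAL) alone** — conclusion = the TYPE of the skeleton's `KatoPerrinRiouIstar.perrinRiouRatioIstarZero_closed` (v4–v12's research
stub 1 VERBATIM): (E) by `hasPRRatioIstarZero_of_facts` (F-CM + GZK), (NV) by §1 (H2X′ + modularity + GZK + the displayed KMC-fine on the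
rows), (VAL) displayed; recomposed through hand -6's split `CccOnePerrinRiouSplit.perrinRiouUpToUnitAt_iff_exists_and_forall_onType_IstarZero`
(PR-INV).  CONDITIONAL on four named facts (all cite conjuncts of the line) and the two displayed hypotheses; (VAL) is NOT proved.
[cite: BurnsKuriharaSano2019, Conj. 2.8 (i)–(ii) (p. 10)] [cite: Kato2004Asterisque, Conj. 12.10 (p. 224), Thm. 12.5 (1) (p. 221), §13.9 (p. 230)]
[cite: PerrinRiou1993AIF, §3.3] -/
theorem perrinRiouRatioIstarZero_of_valuation_of_kmcFineContra
    (hloc : Kato2004.exists_iwasawaH2Data_fineSelmerDual_embedding_loc) (hmod : ModularForms.exists_isNewformOf)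
    (hFCM : Kato2004.exists_isAdmissibleZetaClass_of_hasCM_of_irreducible)
    (hGZK : rank_eq_analyticRank_of_analyticRank_le_one)
    (hKMC : ∀ (p : ℕ) [Fact p.Prime], 5 ≤ p → ∀ (W : WeierstrassCurve ℚ) [W.IsElliptic] [W.IsGloballyMinimal],
      HasSignedLocalType W p (.Istar 0) → W.analyticRank = 1 → KatoMainConjectureFineContra W p)
    (hVAL : ∀ (p : ℕ) [Fact p.Prime], 5 ≤ p → ∀ (W : WeierstrassCurve ℚ) [W.IsElliptic] [W.IsGloballyMinimal],
      HasSignedLocalType W p (.Istar 0) → W.analyticRank = 1 →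
      ∀ ℒ : ℚ_[p], Kato2004.PRRatio W p ℒ →
        ∃ q : ℚ, W.leadingLCoeff / ((W.realPeriodRat : ℂ) * (W.regulator : ℂ)) = (q : ℂ) ∧
          ℒ.valuation = padicValRat p q) :
    ∀ (p : ℕ) [Fact p.Prime], 5 ≤ p → ∀ (W : WeierstrassCurve ℚ) [W.IsElliptic] [W.IsGloballyMinimal],
      HasSignedLocalType W p (.Istar 0) → W.analyticRank = 1 →
      PerrinRiouUpToUnitAt Kato2004.PRRatio W p :=
  (CccOnePerrinRiouSplit.perrinRiouUpToUnitAt_iff_exists_and_forall_onType_IstarZero hmod hGZK).mpr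
    ⟨hasPRRatioIstarZero_of_facts hFCM hGZK,
      fun p _ hp W _ _ hT hr ℒ hℒ =>
        perrinRiouNonvanishingIstarZero_of_kmcFineContra hloc hmod hGZK p hp W hT hr (hKMC p hp W hT hr) ℒ hℒ,
      hVAL⟩

end Summit.BirchSwinnertonDyer.BirchSwinnertonDyer.Theorems.CccOneHasPRRatio

end
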